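import Summits.AtomisticToContinuum.Crystallization.Theorems.PricedLinkCensusLocalToGlobalThomsonEscapeProfile

/-!
# The escape flux of a smeared charge and non-emptiness of the admissible confined fluxes

Route `PricedLinkCensus`, crux `LocalToGlobal` (stmt-AtomisticToContinuum-14232), line
`flux-cell-joint-census`, support for the registered stub `stub_confinedThomson : ConfinedThomson`.
`tubeEnergy Ω x ε G` is an infimum over `admissible Ω x ε G` with `sInf ∅ = 0`, so every use of
`fluxCell` as an upper bound needs an EXPLICIT admissible flux.  Here it is:

  `F = 𝟙_{tube Ω} G + escapeFlux x ε`,  `escapeFlux x ε = (vol B(ι x, ε))⁻¹ · H_{g_∞}`,  `g_∞ = 𝟙_{(-∞, ε²)}`,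

`H_g = Q_g · perp` the transverse radial field of `PricedLinkCensusLocalToGlobalThomsonEscapeProfile`.
The sharp profile `g_∞` is the pointwise limit of the smooth cut-offs `g_n = cutoffProfile (ε - ε/(n+2)) ε`, so
`H_{g_n} → H_{g_∞}` pointwise with the local bound `‖H_{g_n}(z)‖ ≤ ‖z‖`; the weak identities
`∫⟪H_{g_n}, ∇φ⟫ = -∫ g_n(‖z - ι x‖²) φ` pass to the limit by dominated convergence, giving
`∫⟪H_{g_∞}, ∇φ⟫ = -∫_{B(ι x, ε)} φ`.  Together with `H_{g_∞} ∈ L²(ℝ⁸)` (weighted bound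
`‖H‖ ≤ ε(1+ε)³ 𝟙[proj z ∈ B(x,ε)] (1 + ‖perp z‖)⁻³` and the slab integrability of
`PricedLinkCensusLocalToGlobalThomsonSplit`) and `H_{g_∞} = 0` off the tube over `B(x, ε) ⊆ Ω`, the field `F`
is admissible: `admissible_nonempty`.

References: folklore; E. H. Lieb, M. Loss, *Analysis* (2001), §9.7 (finite energy needs `≥ 3`
transverse dimensions).
-/

noncomputable section

open MeasureTheory Set Filter Metric Topology InnerProductSpace Function
open scoped RealInnerProductSpace ContDiff
open Literature.Analysis.FluidPDE (cutoffProfile cutoffProfile_contDiff cutoffProfile_nonneg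
  cutoffProfile_le_one cutoffProfile_eq_one cutoffProfile_eq_zero)

namespace Summit.AtomisticToContinuum.Crystallization.Theorems.PricedLinkCensusLocalToGlobal

variable {x : E3} {ε : ℝ}

/-! ### The profiles -/

/-- The inner radii `r_n = ε - ε/(n+2)` satisfy `0 ≤ r_n < ε` for `ε > 0`. [folklore] -/
theorem escapeRadius_bounds (hε : 0 < ε) (n : ℕ) : 0 ≤ ε - ε / ((n : ℝ) + 2) ∧ ε - ε / ((n : ℝ) + 2) < ε := by
  have h2 : (0 : ℝ) < (n : ℝ) + 2 := by positivity
  constructor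
  · rw [sub_nonneg, div_le_iff₀ h2]; nlinarith
  · linarith [div_pos hε h2]

/-- `g_n` is smooth. [folklore] -/
theorem contDiff_escapeBump (ε : ℝ) (n : ℕ) : ContDiff ℝ ∞ (escapeBump ε n) :=
  cutoffProfile_contDiff _ _ (n := ⊤)

/-- `0 ≤ g_n`. [folklore] -/
theorem escapeBump_nonneg (ε : ℝ) (n : ℕ) (s : ℝ) : 0 ≤ escapeBump ε n s := cutoffProfile_nonneg _ _ _

/-- `g_n ≤ 1`. [folklore] -/
theorem escapeBump_le_one (ε : ℝ) (n : ℕ) (s : ℝ) : escapeBump ε n s ≤ 1 := cutoffProfile_le_one _ _ _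

/-- `g_n(s) = 0` for `s ≥ ε²`. [folklore] -/
theorem escapeBump_eq_zero (hε : 0 < ε) (n : ℕ) {s : ℝ} (hs : ε ^ 2 ≤ s) : escapeBump ε n s = 0 :=
  cutoffProfile_eq_zero (escapeRadius_bounds hε n).1 (escapeRadius_bounds hε n).2 hs

/-- `g_n → g_∞` pointwise. [folklore] -/
theorem tendsto_escapeBump (hε : 0 < ε) (s : ℝ) :
    Tendsto (fun n => escapeBump ε n s) atTop (𝓝 (sharpProfile ε s)) := by
  unfold sharpProfile
  split_ifs with hs
  · -- `s < ε²`: eventually `s ≤ r_n²` and `g_n(s) = 1`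
    have hr : Tendsto (fun n : ℕ => ε - ε / ((n : ℝ) + 2)) atTop (𝓝 ε) := by
      have h1 : Tendsto (fun n : ℕ => ε / ((n : ℝ) + 2)) atTop (𝓝 0) := by
        have := (tendsto_const_div_atTop_nhds_zero_nat ε).comp (tendsto_add_atTop_nat 2)
        refine this.congr fun n => ?_
        simp [Function.comp, Nat.cast_add]
      simpa using (tendsto_const_nhds (x := ε)).sub h1
    have hr2 : Tendsto (fun n : ℕ => (ε - ε / ((n : ℝ) + 2)) ^ 2) atTop (𝓝 (ε ^ 2)) := hr.pow 2
    refine tendsto_const_nhds.congr' ?_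
    filter_upwards [(tendsto_order.1 hr2).1 s hs] with n hn
    exact (cutoffProfile_eq_one (escapeRadius_bounds hε n).1 (escapeRadius_bounds hε n).2 hn.le).symm
  · refine tendsto_const_nhds.congr fun n => ?_
    exact (escapeBump_eq_zero hε n (not_lt.1 hs)).symm

/-- `0 ≤ g_∞`. [folklore] -/
theorem sharpProfile_nonneg (ε s : ℝ) : 0 ≤ sharpProfile ε s := by
  unfold sharpProfile; split_ifs <;> norm_num

/-- `g_∞ ≤ 1`. [folklore] -/
theorem sharpProfile_le_one (ε s : ℝ) : sharpProfile ε s ≤ 1 := by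
  unfold sharpProfile; split_ifs <;> norm_num

/-- `g_∞(s) = 0` for `s ≥ ε²`. [folklore] -/
theorem sharpProfile_eq_zero {s : ℝ} (hs : ε ^ 2 ≤ s) : sharpProfile ε s = 0 := by
  unfold sharpProfile; rw [if_neg (not_lt.2 hs)]

/-- `g_∞(‖z - ι x‖²) = 𝟙_{B(ι x, ε)}(z)` for `ε > 0`. [folklore] -/
theorem sharpProfile_norm_sub_sq (hε : 0 < ε) (z : E8) :
    sharpProfile ε (‖z - emb x‖ ^ 2) = (ball (emb x) ε).indicator (fun _ => (1 : ℝ)) z := by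
  unfold sharpProfile
  have hiff : ‖z - emb x‖ ^ 2 < ε ^ 2 ↔ z ∈ ball (emb x) ε := by
    rw [mem_ball, dist_eq_norm, sq_lt_sq, abs_of_nonneg (norm_nonneg _), abs_of_pos hε]
  by_cases hz : z ∈ ball (emb x) ε
  · rw [if_pos (hiff.2 hz), indicator_of_mem hz]
  · rw [if_neg (fun h => hz (hiff.1 h)), indicator_of_notMem hz]

/-! ### The limit field -/

/-- **Pointwise convergence of the coefficients** `Q_{g_n}(z) → Q_{g_∞}(z)` (dominated convergence on
`[0, 1]`, majorant `1`). [folklore] -/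
theorem tendsto_escapeCoeff (hε : 0 < ε) (x : E3) (z : E8) :
    Tendsto (fun n => escapeCoeff (escapeBump ε n) x z) atTop (𝓝 (escapeCoeff (sharpProfile ε) x z)) := by
  unfold escapeCoeff
  refine intervalIntegral.tendsto_integral_filter_of_dominated_convergence (fun _ => 1) ?_ ?_ ?_ ?_
  · refine Eventually.of_forall fun n => Continuous.aestronglyMeasurable ?_
    exact (contDiff_escapeIntegrand (contDiff_escapeBump ε n) x).continuous.comp
      (continuous_id.prodMk continuous_const)
  · refine Eventually.of_forall fun n => Eventually.of_forall fun w hw => ?_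
    rw [Set.uIoc_of_le zero_le_one] at hw
    simp only [escapeIntegrand, Real.norm_eq_abs, abs_mul, abs_pow, abs_of_nonneg hw.1.le]
    rw [abs_of_nonneg (escapeBump_nonneg _ _ _)]
    exact mul_le_one₀ (pow_le_one₀ hw.1.le hw.2) (escapeBump_nonneg _ _ _) (escapeBump_le_one _ _ _)
  · exact _root_.intervalIntegrable_const
  · refine Eventually.of_forall fun w _ => ?_
    simp only [escapeIntegrand]
    exact (tendsto_escapeBump hε _).const_mul _

/-- **Pointwise convergence of the fields** `H_{g_n}(z) → H_{g_∞}(z)`. [folklore] -/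
theorem tendsto_escapeField (hε : 0 < ε) (x : E3) (z : E8) :
    Tendsto (fun n => escapeField (escapeBump ε n) x z) atTop (𝓝 (escapeField (sharpProfile ε) x z)) :=
  (tendsto_escapeCoeff hε x z).smul_const (perpL z)

/-- The limit field is a.e.-strongly measurable (pointwise limit of continuous fields). [folklore] -/
theorem aestronglyMeasurable_escapeField_sharp (hε : 0 < ε) (x : E3) :
    AEStronglyMeasurable (escapeField (sharpProfile ε) x) (volume : Measure E8) :=
  aestronglyMeasurable_of_tendsto_ae atTop
    (fun n => (contDiff_escapeField (contDiff_escapeBump ε n) x).continuous.aestronglyMeasurable)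
    (Eventually.of_forall fun z => tendsto_escapeField hε x z)

/-- **Weak divergence of the limit field**: `∫ ⟪H_{g_∞}, ∇φ⟫ = -∫_{B(ι x, ε)} φ` for `φ ∈ C¹_c(ℝ⁸)`. [folklore] -/
theorem integral_inner_escapeField_sharp (hε : 0 < ε) (x : E3) {φ : E8 → ℝ} (hφ : ContDiff ℝ 1 φ)
    (hφc : HasCompactSupport φ) :
    ∫ z, ⟪escapeField (sharpProfile ε) x z, gradient φ z⟫ = -∫ z in ball (emb x) ε, φ z := by
  have hgradc : Continuous (gradient φ) := Literature.Analysis.FluidPDE.continuous_gradient_of_contDiff hφ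
  have hgrads : HasCompactSupport (gradient φ) := by
    have h := hφc.fderiv (𝕜 := ℝ)
    exact h.comp_left (g := fun L : E8 →L[ℝ] ℝ => (InnerProductSpace.toDual ℝ E8).symm L) (map_zero _)
  -- the identities for the smooth profiles
  have hn : ∀ n, ∫ z, ⟪escapeField (escapeBump ε n) x z, gradient φ z⟫ =
      -∫ z, escapeBump ε n (‖z - emb x‖ ^ 2) * φ z := fun n =>
    integral_inner_escapeField (contDiff_escapeBump ε n) x hφ hφc
  -- left-hand sides converge
  have hL : Tendsto (fun n => ∫ z, ⟪escapeField (escapeBump ε n) x z, gradient φ z⟫) atTop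
      (𝓝 (∫ z, ⟪escapeField (sharpProfile ε) x z, gradient φ z⟫)) := by
    refine tendsto_integral_of_dominated_convergence (fun z => ‖z‖ * ‖gradient φ z‖) (fun n => ?_) ?_
      (fun n => Eventually.of_forall fun z => ?_) (Eventually.of_forall fun z => ?_)
    · exact ((contDiff_escapeField (contDiff_escapeBump ε n) x).continuous.inner hgradc).aestronglyMeasurable
    · exact (continuous_norm.mul hgradc.norm).integrable_of_hasCompactSupport (hgrads.norm.mul_left)
    · rw [Real.norm_eq_abs]
      exact (abs_real_inner_le_norm _ _).trans (mul_le_mul_of_nonneg_right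
        (norm_escapeField_le_norm (escapeBump_le_one ε n) (escapeBump_nonneg ε n) x z) (norm_nonneg _))
    · exact (tendsto_escapeField hε x z).inner tendsto_const_nhds
  -- right-hand sides converge
  have hR : Tendsto (fun n => -∫ z, escapeBump ε n (‖z - emb x‖ ^ 2) * φ z) atTop
      (𝓝 (-∫ z, sharpProfile ε (‖z - emb x‖ ^ 2) * φ z)) := by
    refine (tendsto_integral_of_dominated_convergence (fun z => ‖φ z‖) (fun n => ?_)
      (hφ.continuous.integrable_of_hasCompactSupport hφc).norm
      (fun n => Eventually.of_forall fun z => ?_) (Eventually.of_forall fun z => ?_)).neg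
    · exact (((contDiff_escapeBump ε n).continuous.comp ((continuous_id.sub continuous_const).norm.pow 2)).mul
        hφ.continuous).aestronglyMeasurable
    · rw [norm_mul, Real.norm_eq_abs, abs_of_nonneg (escapeBump_nonneg _ _ _)]
      exact mul_le_of_le_one_left (norm_nonneg _) (escapeBump_le_one _ _ _)
    · exact (tendsto_escapeBump hε _).mul_const _
  have hlim := tendsto_nhds_unique (hL.congr hn) hR
  rw [hlim]
  congr 1
  rw [← MeasureTheory.integral_indicator measurableSet_ball]
  refine integral_congr_ae (Eventually.of_forall fun z => ?_)
  simp only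
  rw [sharpProfile_norm_sub_sq hε z]
  by_cases hz : z ∈ ball (emb x) ε
  · rw [indicator_of_mem hz, indicator_of_mem hz, one_mul]
  · rw [indicator_of_notMem hz, indicator_of_notMem hz, zero_mul]

/-- **The limit field is square integrable** (`‖H‖ ≤ ε(1+ε)³ 𝟙[proj z ∈ B(x,ε)](1 + ‖perp z‖)⁻³` and slab
integrability of the squared majorant, `6 > 5`). [cite: LiebLoss2001, Thm 9.7] -/
theorem memLp_escapeField_sharp (hε : 0 < ε) (x : E3) : MemLp (escapeField (sharpProfile ε) x) 2 volume := by
  have hbound : ∀ z, ‖escapeField (sharpProfile ε) x z‖ ≤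
      (ball x ε).indicator (fun _ => ε * (1 + ε) ^ 3) (proj z) * (1 + ‖perpL z‖)⁻¹ ^ 3 := fun z => by
    by_cases hz : proj z ∈ ball x ε
    · rw [indicator_of_mem hz]
      exact norm_escapeField_le_weight hε (sharpProfile_le_one ε) (sharpProfile_nonneg ε)
        (fun s hs => sharpProfile_eq_zero hs) x z
    · have h0 : escapeField (sharpProfile ε) x z = 0 := by
        by_contra h
        exact hz (proj_mem_ball_of_escapeField_ne_zero (fun s hs => sharpProfile_eq_zero hs) hε.le x h)
      rw [h0, norm_zero, indicator_of_notMem hz, zero_mul]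
  have hMm : AEStronglyMeasurable (fun z : E8 => (ball x ε).indicator (fun _ => ε * (1 + ε) ^ 3) (proj z) *
      (1 + ‖perpL z‖)⁻¹ ^ 3) volume := by
    refine (Measurable.aestronglyMeasurable ?_)
    refine Measurable.mul ?_ ?_
    · exact (measurable_const.indicator measurableSet_ball).comp (projL : E8 →L[ℝ] E3).continuous.measurable
    · exact ((measurable_const.add (perpL : E8 →L[ℝ] E8).continuous.measurable.norm).inv.pow_const 3)
  have hM2 : MemLp (fun z : E8 => (ball x ε).indicator (fun _ => ε * (1 + ε) ^ 3) (proj z) *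
      (1 + ‖perpL z‖)⁻¹ ^ 3) 2 volume := by
    rw [memLp_two_iff_integrable_sq hMm]
    have hint := integrable_slab_weight x ε ((ε * (1 + ε) ^ 3) ^ 2) (by norm_num : (5 : ℝ) < 6)
    refine hint.congr (Eventually.of_forall fun z => ?_)
    have h6 : ((1 + ‖perpL z‖)⁻¹ ^ 3) ^ 2 = (1 + ‖perpL z‖) ^ (-(6 : ℝ)) := by
      rw [← pow_mul, Real.rpow_neg (by positivity), inv_pow, show ((6 : ℝ)) = ((6 : ℕ) : ℝ) by norm_num,
        Real.rpow_natCast]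
    simp only
    rw [← h6]
    by_cases hz : proj z ∈ ball x ε
    · rw [indicator_of_mem hz, indicator_of_mem hz]; ring
    · rw [indicator_of_notMem hz, indicator_of_notMem hz]; ring
  refine MemLp.of_le hM2 (aestronglyMeasurable_escapeField_sharp hε x) (Eventually.of_forall fun z => ?_)
  rw [Real.norm_eq_abs]
  exact (hbound z).trans (le_abs_self _)

/-! ### The escape flux and admissibility -/

/-- The escape flux is square integrable. [folklore] -/
theorem memLp_escapeFlux (hε : 0 < ε) (x : E3) : MemLp (escapeFlux x ε) 2 volume :=
  (memLp_escapeField_sharp hε x).const_smul ((volume : Measure E8).real (ball (emb x) ε))⁻¹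

/-- The escape flux vanishes off the tube over `B(x, ε)`. [folklore] -/
theorem escapeFlux_eq_zero (hε : 0 < ε) {z : E8} (hz : proj z ∉ ball x ε) : escapeFlux x ε z = 0 := by
  rw [escapeFlux]
  by_contra h
  have h' : escapeField (sharpProfile ε) x z ≠ 0 := fun h0 => h (by rw [h0, smul_zero])
  exact hz (proj_mem_ball_of_escapeField_ne_zero (fun s hs => sharpProfile_eq_zero hs) hε.le x h')

/-- **Weak divergence of the escape flux**: `∫ ⟪escapeFlux, ∇φ⟫ = -⨍_{B(ι x, ε)} φ`. [folklore] -/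
theorem integral_inner_escapeFlux (hε : 0 < ε) (x : E3) {φ : E8 → ℝ} (hφ : ContDiff ℝ 1 φ)
    (hφc : HasCompactSupport φ) :
    ∫ z, ⟪escapeFlux x ε z, gradient φ z⟫ = -⨍ z in ball (emb x) ε, φ z := by
  simp only [escapeFlux, real_inner_smul_left]
  rw [MeasureTheory.integral_const_mul, integral_inner_escapeField_sharp hε x hφ hφc, setAverage_eq, smul_eq_mul,
    mul_neg]

variable {Ω : Set E3} {G : E8 → E8}

/-- `proj` is continuous. [folklore] -/
theorem continuous_proj : Continuous proj := (projL : E8 →L[ℝ] E3).continuous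

/-- Tubes over open cells are measurable. [folklore] -/
theorem measurableSet_tube (hΩ : IsOpen Ω) : MeasurableSet (tube Ω) := (hΩ.preimage continuous_proj).measurableSet

/-- **Non-emptiness of the admissible confined fluxes.** For an open cell `Ω ⊇ B(x, ε)` and a
square-integrable transfer field `G`, `F = 𝟙_{tube Ω} G + escapeFlux x ε` (the escape flux omitted when
`ε ≤ 0`) is admissible: `admissible Ω x ε G ≠ ∅`. [folklore] -/
theorem admissible_nonempty (hΩ : IsOpen Ω) (hball : ball x ε ⊆ Ω) (hG : MemLp G 2 volume) :
    (admissible Ω x ε G).Nonempty := by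
  have htm := measurableSet_tube hΩ
  by_cases hε : 0 < ε
  · refine ⟨fun z => (tube Ω).indicator G z + escapeFlux x ε z, ?_, ?_, ?_⟩
    · exact (hG.indicator htm).add (memLp_escapeFlux hε x)
    · intro z hz
      have hz' : proj z ∉ ball x ε := fun h => hz (hball h)
      show (tube Ω).indicator G z + escapeFlux x ε z = 0
      rw [indicator_of_notMem hz, escapeFlux_eq_zero hε hz', add_zero]
    · intro φ hφ
      have h1 : ∫ z in tube Ω, ⟪(tube Ω).indicator G z + escapeFlux x ε z - G z, gradient φ z⟫ =
          ∫ z in tube Ω, ⟪escapeFlux x ε z, gradient φ z⟫ :=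
        setIntegral_congr_fun htm fun z hz => by rw [indicator_of_mem hz, add_sub_cancel_left]
      rw [h1, setIntegral_eq_integral_of_forall_compl_eq_zero fun z hz => ?_, integral_inner_escapeFlux hε x hφ.1 hφ.2]
      rw [escapeFlux_eq_zero hε (fun h => hz (hball h)), inner_zero_left]
  · refine ⟨fun z => (tube Ω).indicator G z, hG.indicator htm, fun z hz => indicator_of_notMem hz _, ?_⟩
    intro φ _
    have h1 : ∫ z in tube Ω, ⟪(tube Ω).indicator G z - G z, gradient φ z⟫ = ∫ z in tube Ω, (0 : ℝ) :=
      setIntegral_congr_fun htm fun z hz => by rw [indicator_of_mem hz, sub_self, inner_zero_left]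
    rw [h1, MeasureTheory.integral_zero, ball_eq_empty.2 (not_lt.1 hε)]
    simp

/-- **Registered sub-goal `admissible_nonempty'`** (line `flux-cell-joint-census`, support of
`stub_confinedThomson`): non-emptiness of the admissible confined fluxes, binder form of `admissible_nonempty`.
[folklore] -/
theorem admissible_nonempty' : ∀ (Ω : Set E3) (x : E3) (ε : ℝ) (G : E8 → E8), IsOpen Ω → Metric.ball x ε ⊆ Ω →
    MeasureTheory.MemLp G 2 MeasureTheory.volume → (admissible Ω x ε G).Nonempty :=
  fun _ _ _ _ hΩ hball hG => admissible_nonempty hΩ hball hG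

end Summit.AtomisticToContinuum.Crystallization.Theorems.PricedLinkCensusLocalToGlobal

end
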